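import Summits.Ventures.HSemireg.WedgeHankelRecurrenceGaussGegenbauerZeros

/-!
# Venture HSemireg — **THE LAGUERRE LOWERING RELATION AND PARAMETER INTERLACING**: for the monic Laguerre recurrences `L = L^{(α)}` (`a_n = 2n+1+α`, `b_{n+1} = (n+1)(n+1+α)`) and `P = L^{(α+1)}`:
# `L_{n+1} = X P_n − (n+1+α) L_n`, `P_{n+1} = L_{n+1} − (n+1) P_n` (the contraction identities), hence with the structure relation N389 **`(L^{(α)}_{n+1})' = (n+1) · L^{(α+1)}_n`**; consequently for
# `α > −1` the zeros `y` of `L^{(α+1)}_t` are the critical points of `L^{(α)}_{t+1}` and INTERLACE its zeros: `x_k < y_k < x_{k+1}`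

HONEST FRAMING. Part of the Lean index of the computation cell `pub-hsemireg` (seat p10 gen 46, Sunday typer «UNIFORM-IN-n»).  Real polynomials, derivatives and finite products only; no variety, no
cohomology theory, no sheaf, no Ext group and no semiregularity map is constructed here; nothing here says that HC / HC_CM / HC_AV holds; no Literature fact (unproved `Prop`) is declared or used.
Custodian versions as in `WedgeHankelSiegelIdeal` (1/3).
SOURCES (cited).  G. Szegő, *Orthogonal Polynomials*, (5.1.13)–(5.1.14) (`L_n^{(α)} = L_n^{(α+1)} − L_{n−1}^{(α+1)}`, `(L_n^{(α)})' = −L_{n−1}^{(α+1)}` in the classical normalisation), Thm 6.21.? ∕ §6.21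
(monotonicity ∕ interlacing in the parameter); M. Abramowitz, I. Stegun, *Handbook*, 22.8.6, 22.7.30; T. S. Chihara, *An Introduction to Orthogonal Polynomials* (1978), Ch. V §3.
PROOF TYPED HERE.  The contraction identities by a simultaneous induction from the two recurrences; lowering: `X L_{n+1}' = (n+1) L_{n+1} + (n+1)(n+1+α) L_n` (N389) `= (n+1) X P_n`, cancel `X`; the
interlacing: N365 `derivative_zero_mem_gap` puts a critical point `η_k` of `L_{t+1}` in every gap, `P_t = ∏ (X − η_k)` (monic of degree `t` vanishing there), and sorted roots are unique (N294
`strictMono_eq_of_prod_X_sub_C_eq`).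
DEDUP DISCLOSURE (`rg -n -i 'laguerre_lowering|laguerre_contraction|laguerre_derivative' Summits/Ventures/HSemireg`, 2026-09-03): N380 `laguerre_kernel_succ` (the recurrence of `P` GIVEN
`X P = L_{n+1} + (n+1+α) L_n`), N389 (structure relation); the identities FROM the two recurrences, the lowering relation and the interlacing are new.  The 3 names below: 0 hits tree-wide.

WHAT IS IN THE TREE.  N389 `laguerre_structure_relation`; N365 `derivative_zero_mem_gap`; N294 `strictMono_eq_of_prod_X_sub_C_eq`; N279 `recurrence_zeros_interlace`, `recurrence_monic_natDegree`,
`eq_prod_X_sub_C_of_monic_of_roots`.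
THIS FILE (namespace `Summit.Ventures.HSemireg.Wedge.HankelOuter` continued; CHAINED on N390 (import only); 0 definitions):
* §1156 **`laguerre_contraction`**, **`laguerre_derivative_lowering`**, **`laguerre_lowering_interlace`**.
CAVEATS.  Monic normalisation; recurrence-only.  Nothing Ext-side.  New names only.
-/

open Module Polynomial
open scoped Matrix Polynomial

namespace Summit.Ventures.HSemireg.Wedge.HankelOuter

/-! ## §1156. Laguerre: lowering the degree, raising the parameter -/

/-- **The contraction identities `L_{n+1} = X P_n − (n+1+α) L_n`, `P_{n+1} = L_{n+1} − (n+1) P_n`** for `L = L^{(α)}`, `P = L^{(α+1)}` (monic recurrences). [Szegő (5.1.13); this file, §1156] -/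
theorem laguerre_contraction {L P : ℕ → ℝ[X]} {a b a' b' : ℕ → ℝ} {α : ℝ} (hL0 : L 0 = 1) (hL1 : L 1 = Polynomial.X - C (a 0))
    (hLrec : ∀ n, L (n + 2) = (Polynomial.X - C (a (n + 1))) * L (n + 1) - C (b (n + 1)) * L n) (ha : ∀ n, a n = 2 * n + 1 + α)
    (hb : ∀ n, b (n + 1) = ((n : ℝ) + 1) * ((n : ℝ) + 1 + α))
    (hP0 : P 0 = 1) (hP1 : P 1 = Polynomial.X - C (a' 0)) (hPrec : ∀ n, P (n + 2) = (Polynomial.X - C (a' (n + 1))) * P (n + 1) - C (b' (n + 1)) * P n)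
    (ha' : ∀ n, a' n = 2 * n + 1 + (α + 1)) (hb' : ∀ n, b' (n + 1) = ((n : ℝ) + 1) * ((n : ℝ) + 1 + (α + 1))) (n : ℕ) :
    L (n + 1) = Polynomial.X * P n - C ((n : ℝ) + 1 + α) * L n ∧ P (n + 1) = L (n + 1) - C ((n : ℝ) + 1) * P n := by
  have hLr : ∀ m, L (m + 2) = (Polynomial.X - (2 * (m : ℝ[X]) + 3 + C α)) * L (m + 1) - (((m : ℝ[X]) + 1) * ((m : ℝ[X]) + 1 + C α)) * L m := fun m => by
    rw [hLrec m, ha, hb]; simp only [map_add, map_mul, map_one, map_natCast, map_ofNat, Nat.cast_add, Nat.cast_one]; ring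
  have hPr : ∀ m, P (m + 2) = (Polynomial.X - (2 * (m : ℝ[X]) + 4 + C α)) * P (m + 1) - (((m : ℝ[X]) + 1) * ((m : ℝ[X]) + 2 + C α)) * P m := fun m => by
    rw [hPrec m, ha', hb']; simp only [map_add, map_mul, map_one, map_natCast, map_ofNat, Nat.cast_add, Nat.cast_one]; ring
  have key : ∀ n, L (n + 1) = Polynomial.X * P n - ((n : ℝ[X]) + 1 + C α) * L n ∧ P (n + 1) = L (n + 1) - ((n : ℝ[X]) + 1) * P n := by
    intro n
    induction n with
    | zero =>
      have h1 : L 1 = Polynomial.X - (1 + C α) := by rw [hL1, ha, Nat.cast_zero, mul_zero, zero_add, map_add, map_one]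
      have h1' : P 1 = Polynomial.X - (2 + C α) := by
        rw [hP1, ha', Nat.cast_zero, mul_zero, zero_add, map_add, map_add, map_one]; ring
      refine ⟨by rw [h1, hP0, hL0]; push_cast; ring, by rw [h1', h1, hP0]; push_cast; ring⟩
    | succ n ih =>
      obtain ⟨i1, i2⟩ := ih
      have e1 : L (n + 2) = Polynomial.X * P (n + 1) - (((n + 1 : ℕ) : ℝ[X]) + 1 + C α) * L (n + 1) := by
        rw [hLr n, i2]; push_cast
        linear_combination (-((n : ℝ[X]) + 1)) * i1
      refine ⟨e1, ?_⟩
      rw [show n + 1 + 1 = n + 2 from rfl, hPr n, e1, i2]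
      push_cast
      ring
  obtain ⟨h1, h2⟩ := key n
  refine ⟨?_, ?_⟩
  · rw [h1]; simp only [map_add, map_one, map_natCast]
  · rw [h2]; simp only [map_add, map_one, map_natCast]

/-- **LOWERING: `(L^{(α)}_{n+1})' = (n + 1) · L^{(α+1)}_n`.** [Szegő (5.1.14); Abramowitz–Stegun 22.8.6; this file, §1156] -/
theorem laguerre_derivative_lowering {L P : ℕ → ℝ[X]} {a b a' b' : ℕ → ℝ} {α : ℝ} (hL0 : L 0 = 1) (hL1 : L 1 = Polynomial.X - C (a 0))
    (hLrec : ∀ n, L (n + 2) = (Polynomial.X - C (a (n + 1))) * L (n + 1) - C (b (n + 1)) * L n) (ha : ∀ n, a n = 2 * n + 1 + α)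
    (hb : ∀ n, b (n + 1) = ((n : ℝ) + 1) * ((n : ℝ) + 1 + α))
    (hP0 : P 0 = 1) (hP1 : P 1 = Polynomial.X - C (a' 0)) (hPrec : ∀ n, P (n + 2) = (Polynomial.X - C (a' (n + 1))) * P (n + 1) - C (b' (n + 1)) * P n)
    (ha' : ∀ n, a' n = 2 * n + 1 + (α + 1)) (hb' : ∀ n, b' (n + 1) = ((n : ℝ) + 1) * ((n : ℝ) + 1 + (α + 1))) (n : ℕ) :
    derivative (L (n + 1)) = C ((n : ℝ) + 1) * P n := by
  have hs := laguerre_structure_relation hL0 hL1 hLrec ha hb n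
  obtain ⟨hc, -⟩ := laguerre_contraction hL0 hL1 hLrec ha hb hP0 hP1 hPrec ha' hb' n
  apply mul_left_cancel₀ (X_ne_zero : (Polynomial.X : ℝ[X]) ≠ 0)
  rw [hs, hc, map_mul]
  ring

/-- **THE ZEROS OF `L^{(α+1)}_t` INTERLACE THOSE OF `L^{(α)}_{t+1}`** (`α > −1`): they are the critical points of `L^{(α)}_{t+1}`, one in each gap — `x_k < y_k < x_{k+1}`. [Szegő §6.21; this file,
§1156] -/
theorem laguerre_lowering_interlace {L P : ℕ → ℝ[X]} {a b a' b' : ℕ → ℝ} {α : ℝ} (hL0 : L 0 = 1) (hL1 : L 1 = Polynomial.X - C (a 0))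
    (hLrec : ∀ n, L (n + 2) = (Polynomial.X - C (a (n + 1))) * L (n + 1) - C (b (n + 1)) * L n) (ha : ∀ n, a n = 2 * n + 1 + α)
    (hb : ∀ n, b (n + 1) = ((n : ℝ) + 1) * ((n : ℝ) + 1 + α))
    (hP0 : P 0 = 1) (hP1 : P 1 = Polynomial.X - C (a' 0)) (hPrec : ∀ n, P (n + 2) = (Polynomial.X - C (a' (n + 1))) * P (n + 1) - C (b' (n + 1)) * P n)
    (ha' : ∀ n, a' n = 2 * n + 1 + (α + 1)) (hb' : ∀ n, b' (n + 1) = ((n : ℝ) + 1) * ((n : ℝ) + 1 + (α + 1))) (hα : -1 < α) (hb0 : 0 < b 0)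
    {t : ℕ} {x : Fin (t + 2) → ℝ} {y : Fin (t + 1) → ℝ} (hx : StrictMono x) (hxq : L (t + 2) = ∏ k, (Polynomial.X - C (x k))) (hy : StrictMono y)
    (hyq : P (t + 1) = ∏ k, (Polynomial.X - C (y k))) (k : Fin (t + 1)) : x k.castSucc < y k ∧ y k < x k.succ := by
  classical
  have hbpos : ∀ j, 0 < b j := fun j => by
    rcases j with _ | n
    · exact hb0
    · rw [hb]; exact mul_pos (by positivity) (by have : (0 : ℝ) ≤ n := Nat.cast_nonneg n; linarith)
  -- a critical point in every gap
  have hgap : ∀ j : Fin (t + 1), ∃ η, x j.castSucc < η ∧ η < x j.succ ∧ (derivative (L (t + 2))).eval η = 0 := fun j => by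
    have hjt : ((j.castSucc : Fin (t + 2)) : ℕ) + 1 ≤ t + 1 := by rw [Fin.val_castSucc]; have := j.isLt; omega
    obtain ⟨η, h1, h2, h3⟩ := derivative_zero_mem_gap hL0 hL1 hLrec hbpos hx hxq j.castSucc hjt
    refine ⟨η, h1, ?_, h3⟩
    have : (⟨(j.castSucc : ℕ) + 1, by omega⟩ : Fin (t + 2)) = j.succ := Fin.ext (by simp)
    rw [this] at h2; exact h2
  choose η hη using hgap
  have hηmono : StrictMono η := fun i j hij => by
    have h1 := (hη i).2.1
    have h2 := (hη j).1
    have hij' : (i : ℕ) < j := Fin.lt_def.1 hij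
    have h3 : x i.succ ≤ x j.castSucc := hx.monotone (by rw [Fin.le_def, Fin.val_succ, Fin.val_castSucc]; omega)
    linarith
  -- `P_t` is monic of degree `t + 1`... namely `P_{t+1}`, vanishing at every `η_j`
  have hlow := laguerre_derivative_lowering hL0 hL1 hLrec ha hb hP0 hP1 hPrec ha' hb' (t + 1)
  have hroot : ∀ j, (P (t + 1)).eval (η j) = 0 := fun j => by
    have h := congrArg (eval (η j)) hlow
    rw [(hη j).2.2, eval_mul, eval_C] at h
    have hne : ((((t + 1 : ℕ) : ℝ)) + 1) ≠ 0 := by positivity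
    exact (mul_eq_zero.1 h.symm).resolve_left (by push_cast at hne ⊢; exact hne)
  obtain ⟨hPm, hPd⟩ := recurrence_monic_natDegree hP0 hP1 hPrec (t + 1)
  have hPη : P (t + 1) = ∏ j, (Polynomial.X - C (η j)) := eq_prod_X_sub_C_of_monic_of_roots hPm hPd hηmono.injective hroot
  have hyη : y = η := strictMono_eq_of_prod_X_sub_C_eq hy hηmono (hyq.symm.trans hPη)
  subst hyη
  exact ⟨(hη k).1, (hη k).2.1⟩

end Summit.Ventures.HSemireg.Wedge.HankelOuter
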